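import Literature.NumberTheory.Rogawski1990.ArchExplicitTransferFactorLocallyConstant  -- ★ F3B (p05): `continuousOn_archExplicitDelta` on `{… ∧ ∀ w, κ_w ≠ 0}`
import Literature.NumberTheory.Rogawski1990.ArchExplicitTransferFactorGHRegular         -- ★ PART 1 (p08): `archKappaAt_ne_zero_of_evalC_ne_zero`
import HarnessLib

/-!
# `Δ″_∞`, `Δ‴_∞` are CONTINUOUS AT EVERY `(G,H)`-REGULAR LOCAL MATCHING PAIR — the junction of «D-G4♭-∞» (Rogawski 1990, Prop. 8.2.1 (a) pp. 117–118;
# Lemma 14.5.2 (b), proof p. 238)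

Topic `NumberTheory/Rogawski1990`; namespace `Literature.NumberTheory.Rogawski1990`.  THEOREMS ONLY (no definition, no named fact, no instance, no
notation, no `sorry`); imports ★ `ArchExplicitTransferFactorLocallyConstant` (F0P3a-p05 (g10)'s F3B, hence F3A `ArchExplicitTransferFactorTauContinuous`)
and ★ `ArchExplicitTransferFactorGHRegular` («D-G4♭-∞» PART 1, F0P3a-p08 (g11)).  Cell `pub/hodgecm-mathlib`, F0∕P3a, seat F0P3a-p08 (g11); LEAD DESK WORD
T6-48 (b): the JUNCTION COROLLARY of the archimedean half of node D-G4 of the #88 repair census `F0/P3a/F0P3a-p05/g9/SIZING-S1prime.v2.F0P3a-p05g9.md`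
(§2 rows (ST-∞-s)∕(κ-arch); §7 «the explicit factor's CONTINUITY at the singular pair … NOT done»).

THE PRINT.  At the singular `γ₀ ∈ M` of [Rogawski1990, Prop. 8.2.1] the endoscopic partner `γ_H = (e₁•1₂, e₂)` is `(G,H)`-regular but not `G`-regular
(`χ_g(γ₂) = (e₂ − e₁)² ≠ 0`).  Print's archimedean identities at `γ₀` ((κ-arch), (ST-∞-s) of the letter S1′) are limits, along `G`-regular matching pairs
`(γ_H δ_t, γ δ_t) → (γ_H, γ₀)`, of the regular transfer identity [Prop. 8.2.1 (a), case `E∕F = ℂ∕ℝ`, pp. 117–118; Lemma 14.5.2 (b), proof p. 238: «the method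
used in the proof of Proposition 8.2.1 gives `Δ_{G∕H}(γ₀) Φ(γ₀, f′_v) = f′^H_v(γ₀)`»], whose transfer-factor input is «`Δ_∞(γ_H δ_t, γ δ_t) → Δ_∞(γ_H, γ₀)`».
★ F3B proves `Δ″_∞`, `Δ‴_∞` (★ `archExplicitDelta`, ★ `archCanonicalDelta`) continuous on `{ι(γ_H) ↔ γ′ ∧ χ_g(γ₂) ∈ (L ⊗ ℝ)ˣ ∧ ∀ w, κ_w ≠ 0}`; ★ PART 1
proves `κ_w ≠ 0` on `{ι(γ_H) ↔ γ′ ∧ χ_g(γ₂) ∈ (L ⊗ ℝ)ˣ}` for a `c`-hermitian anisotropic `H′`.  Hence (this file, `hherm`, `hanis` as in ★ N2∞):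
* `prod_archKappaAt_eventually_eq_of_isUnit_eval` — `∏_w κ_w` is locally constant near every point of the `(G,H)`-REGULAR MATCHING LOCUS
  `S = {(γ_H, γ′) | IsArchNormPair L H′ γ_H γ′ ∧ IsUnit ((archCharpolyTwo L γ_H).eval (archGammaTwo L γ_H))}`;
* **`continuousOn_archExplicitDelta_of_isUnit_eval`**, **`continuousOn_archCanonicalDelta_of_isUnit_eval`** — `Δ″_∞`, `Δ‴_∞` are continuous ON `S`; pointwise
  `continuousWithinAt_archCanonicalDelta_of_isUnit_eval`;
* **`tendsto_archCanonicalDelta_of_isUnit_eval`**, `tendsto_archExplicitDelta_of_isUnit_eval` — the print-shaped LIMIT FORM: along any filter, a family of pairs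
  in `S` converging to a pair in `S` has convergent `Δ‴_∞` (resp. `Δ″_∞`) — «`Δ_∞(γ_H δ_t, γ δ_t) → Δ_∞(γ_H, γ₀)`» at a LOCAL `(G,H)`-regular pair.
HONEST LABEL: HC_CM is proved only modulo the printed citations until rung 0 closes; count-neutral brick toward the letter S1′
`stub_tamagawaSingularMembers_exist` of `Cruxes/H413/Lines/F0_P3a_SingularEllipticTransferPaydown.lean` (the continuity DATA input of (κ-arch)∕(ST-∞-s); the
harmonic analysis D1′–D3′ of those rows remains print) — no stub closes.

## References
* [Rogawski1990] J. D. Rogawski, *Automorphic Representations of Unitary Groups in Three Variables*, Ann. of Math. Stud. 123 (1990), §8.2 Prop. 8.2.1 (a)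
  pp. 117–118; §14.5 Lemma 14.5.2 (b), proof p. 238; §14.6 p. 242.
* [LanglandsShelstad1987] R. P. Langlands, D. Shelstad, *On the definition of transfer factors*, Math. Ann. 278 (1987), §2, Lemma 4.1.A.
-/

set_option autoImplicit false

noncomputable section

open NumberField NumberField.InfinitePlace Matrix Polynomial Filter Topology
open Literature.NumberTheory.GaloisRepresentations
open Literature.AlgebraicGeometry.ShimuraVarieties (hermForm)
open scoped MatrixGroups

namespace Literature.NumberTheory.Rogawski1990

open Literature.NumberTheory.Automorphic

variable (L : Type) [Field L] [NumberField L] [IsCMField L] (H' : Matrix (Fin 3) (Fin 3) L)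

omit [NumberField L] [IsCMField L] in
/-- A unit of `L ⊗ ℝ` is non-zero at every complex place. [folklore] -/
private theorem evalC_ne_zero_of_isUnit_j {x : mixedEmbedding.mixedSpace L} (hx : IsUnit x) (w : {w : InfinitePlace L // IsComplex w}) :
    UnitaryGroup.evalC L w x ≠ 0 := by
  rw [UnitaryGroup.evalC_apply]
  exact ((Pi.isUnit_iff.1 (Prod.isUnit_iff.1 hx).2) w).ne_zero

/-- On the `(G,H)`-regular matching locus NO `κ_w` VANISHES (★ PART 1 `archKappaAt_ne_zero_of_evalC_ne_zero` at every complex place): the inclusion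
`{ι(γ_H) ↔ γ′ ∧ χ_g(γ₂) unit} ⊆ {ι(γ_H) ↔ γ′ ∧ χ_g(γ₂) unit ∧ ∀ w, κ_w ≠ 0}` along which ★ F3B is restricted. [cite: Rogawski1990, §14.6 p. 242] -/
theorem setOf_isArchNormPair_isUnit_subset (hherm : (H'.map (cmConjRingHom L)).transpose = H')
    (hanis : ∀ x : Fin 3 → L, hermForm (cmConjRingHom L) H' x x = 0 → x = 0) :
    {q : (↥(UnitaryGroup.arch (↥(maximalRealSubfield L)) L (IsCMField.complexConj L) 2
          (Matrix.of fun i j : Fin 2 => if i.val + j.val + 1 = 2 then (1 : L) else 0)) ×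
        ↥(UnitaryGroup.arch (↥(maximalRealSubfield L)) L (IsCMField.complexConj L) 1
          (Matrix.of fun i j : Fin 1 => if i.val + j.val + 1 = 1 then (1 : L) else 0))) ×
        ↥(UnitaryGroup.arch (↥(maximalRealSubfield L)) L (IsCMField.complexConj L) 3 H') | IsArchNormPair L H' q.1 q.2 ∧ IsUnit ((archCharpolyTwo L q.1).eval (archGammaTwo L q.1))} ⊆
      {q | IsArchNormPair L H' q.1 q.2 ∧ IsUnit ((archCharpolyTwo L q.1).eval (archGammaTwo L q.1)) ∧
        ∀ w : {w : InfinitePlace L // IsComplex w}, archKappaAt L H' q.1 w q.2 ≠ 0} :=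
  fun q hq => ⟨hq.1, hq.2, fun w => archKappaAt_ne_zero_of_evalC_ne_zero L H' q.1 q.2 w hherm hanis hq.1 (evalC_ne_zero_of_isUnit_j L hq.2 w)⟩

open scoped Classical in
/-- **`∏_w κ_w` IS LOCALLY CONSTANT near every `(G,H)`-regular local matching pair** (`H′` `c`-hermitian anisotropic) — ★ F3B
`prod_archKappaAt_eventually_eq_of_forall_ne_zero` with its hypothesis supplied by ★ PART 1. [cite: Rogawski1990, §14.6 p. 242] [cite: LanglandsShelstad1987, Lemma 4.1.A] -/
theorem prod_archKappaAt_eventually_eq_of_isUnit_eval (hherm : (H'.map (cmConjRingHom L)).transpose = H')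
    (hanis : ∀ x : Fin 3 → L, hermForm (cmConjRingHom L) H' x x = 0 → x = 0)
    {a₀ : (↥(UnitaryGroup.arch (↥(maximalRealSubfield L)) L (IsCMField.complexConj L) 2
          (Matrix.of fun i j : Fin 2 => if i.val + j.val + 1 = 2 then (1 : L) else 0)) ×
        ↥(UnitaryGroup.arch (↥(maximalRealSubfield L)) L (IsCMField.complexConj L) 1
          (Matrix.of fun i j : Fin 1 => if i.val + j.val + 1 = 1 then (1 : L) else 0)))} {b₀ : ↥(UnitaryGroup.arch (↥(maximalRealSubfield L)) L (IsCMField.complexConj L) 3 H')} (hp : IsArchNormPair L H' a₀ b₀) (hunit : IsUnit ((archCharpolyTwo L a₀).eval (archGammaTwo L a₀))) :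
    ∀ᶠ q in 𝓝 (a₀, b₀),
      (∏ w : {w : InfinitePlace L // IsComplex w}, archKappaAt L H' q.1 w q.2) =
        ∏ w : {w : InfinitePlace L // IsComplex w}, archKappaAt L H' a₀ w b₀ :=
  prod_archKappaAt_eventually_eq_of_forall_ne_zero L H' fun w =>
    archKappaAt_ne_zero_of_evalC_ne_zero L H' a₀ b₀ w hherm hanis hp (evalC_ne_zero_of_isUnit_j L hunit w)

/-- **`Δ″_∞` IS CONTINUOUS ON THE `(G,H)`-REGULAR MATCHING LOCUS** `{(γ_H, γ′) | ι(γ_H) ↔ γ′ ∧ χ_g(γ₂) ∈ (L ⊗ ℝ)ˣ}` for a `c`-hermitian anisotropic `H′` and any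
Hecke character `μ` (★ F3B `continuousOn_archExplicitDelta` restricted along `setOf_isArchNormPair_isUnit_subset`).
[cite: Rogawski1990, §8.2 Prop. 8.2.1 (a) pp. 117–118; §14.5 Lemma 14.5.2 (b) proof p. 238; §14.6 p. 242] -/
theorem continuousOn_archExplicitDelta_of_isUnit_eval (hherm : (H'.map (cmConjRingHom L)).transpose = H')
    (hanis : ∀ x : Fin 3 → L, hermForm (cmConjRingHom L) H' x x = 0 → x = 0) (μ : HeckeCharacter L) :
    ContinuousOn (fun q : (↥(UnitaryGroup.arch (↥(maximalRealSubfield L)) L (IsCMField.complexConj L) 2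
          (Matrix.of fun i j : Fin 2 => if i.val + j.val + 1 = 2 then (1 : L) else 0)) ×
        ↥(UnitaryGroup.arch (↥(maximalRealSubfield L)) L (IsCMField.complexConj L) 1
          (Matrix.of fun i j : Fin 1 => if i.val + j.val + 1 = 1 then (1 : L) else 0))) ×
        ↥(UnitaryGroup.arch (↥(maximalRealSubfield L)) L (IsCMField.complexConj L) 3 H') => archExplicitDelta L H' q.1 μ q.2)
      {q : (↥(UnitaryGroup.arch (↥(maximalRealSubfield L)) L (IsCMField.complexConj L) 2
          (Matrix.of fun i j : Fin 2 => if i.val + j.val + 1 = 2 then (1 : L) else 0)) ×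
        ↥(UnitaryGroup.arch (↥(maximalRealSubfield L)) L (IsCMField.complexConj L) 1
          (Matrix.of fun i j : Fin 1 => if i.val + j.val + 1 = 1 then (1 : L) else 0))) ×
        ↥(UnitaryGroup.arch (↥(maximalRealSubfield L)) L (IsCMField.complexConj L) 3 H') | IsArchNormPair L H' q.1 q.2 ∧ IsUnit ((archCharpolyTwo L q.1).eval (archGammaTwo L q.1))} :=
  (continuousOn_archExplicitDelta L H' μ).mono (setOf_isArchNormPair_isUnit_subset L H' hherm hanis)

/-- **`Δ‴_∞` IS CONTINUOUS ON THE `(G,H)`-REGULAR MATCHING LOCUS** — the factor OF RECORD ★ `archCanonicalDelta` (= `(archCanonicalTransferFactor L H′ μ).Δ`);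
the D-G4-∞ head SIZING-S1′ §7 asks for («`Δ‴_∞` continuous AT the `(G,H)`-regular singular pair»).
[cite: Rogawski1990, §8.2 Prop. 8.2.1 (a) pp. 117–118; §14.5 Lemma 14.5.2 (b) proof p. 238] -/
theorem continuousOn_archCanonicalDelta_of_isUnit_eval (hherm : (H'.map (cmConjRingHom L)).transpose = H')
    (hanis : ∀ x : Fin 3 → L, hermForm (cmConjRingHom L) H' x x = 0 → x = 0) (μ : HeckeCharacter L) :
    ContinuousOn (fun q : (↥(UnitaryGroup.arch (↥(maximalRealSubfield L)) L (IsCMField.complexConj L) 2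
          (Matrix.of fun i j : Fin 2 => if i.val + j.val + 1 = 2 then (1 : L) else 0)) ×
        ↥(UnitaryGroup.arch (↥(maximalRealSubfield L)) L (IsCMField.complexConj L) 1
          (Matrix.of fun i j : Fin 1 => if i.val + j.val + 1 = 1 then (1 : L) else 0))) ×
        ↥(UnitaryGroup.arch (↥(maximalRealSubfield L)) L (IsCMField.complexConj L) 3 H') => archCanonicalDelta L H' q.1 μ q.2)
      {q : (↥(UnitaryGroup.arch (↥(maximalRealSubfield L)) L (IsCMField.complexConj L) 2
          (Matrix.of fun i j : Fin 2 => if i.val + j.val + 1 = 2 then (1 : L) else 0)) ×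
        ↥(UnitaryGroup.arch (↥(maximalRealSubfield L)) L (IsCMField.complexConj L) 1
          (Matrix.of fun i j : Fin 1 => if i.val + j.val + 1 = 1 then (1 : L) else 0))) ×
        ↥(UnitaryGroup.arch (↥(maximalRealSubfield L)) L (IsCMField.complexConj L) 3 H') | IsArchNormPair L H' q.1 q.2 ∧ IsUnit ((archCharpolyTwo L q.1).eval (archGammaTwo L q.1))} :=
  (continuousOn_archCanonicalDelta L H' μ).mono (setOf_isArchNormPair_isUnit_subset L H' hherm hanis)

/-- Pointwise: **`Δ‴_∞` is continuous within the `(G,H)`-regular matching locus at each of its points.** [cite: Rogawski1990, §14.5 Lemma 14.5.2 (b) proof p. 238] -/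
theorem continuousWithinAt_archCanonicalDelta_of_isUnit_eval (hherm : (H'.map (cmConjRingHom L)).transpose = H')
    (hanis : ∀ x : Fin 3 → L, hermForm (cmConjRingHom L) H' x x = 0 → x = 0) (μ : HeckeCharacter L)
    {a₀ : (↥(UnitaryGroup.arch (↥(maximalRealSubfield L)) L (IsCMField.complexConj L) 2
          (Matrix.of fun i j : Fin 2 => if i.val + j.val + 1 = 2 then (1 : L) else 0)) ×
        ↥(UnitaryGroup.arch (↥(maximalRealSubfield L)) L (IsCMField.complexConj L) 1
          (Matrix.of fun i j : Fin 1 => if i.val + j.val + 1 = 1 then (1 : L) else 0)))} {b₀ : ↥(UnitaryGroup.arch (↥(maximalRealSubfield L)) L (IsCMField.complexConj L) 3 H')} (hp : IsArchNormPair L H' a₀ b₀) (hunit : IsUnit ((archCharpolyTwo L a₀).eval (archGammaTwo L a₀))) :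
    ContinuousWithinAt (fun q : (↥(UnitaryGroup.arch (↥(maximalRealSubfield L)) L (IsCMField.complexConj L) 2
          (Matrix.of fun i j : Fin 2 => if i.val + j.val + 1 = 2 then (1 : L) else 0)) ×
        ↥(UnitaryGroup.arch (↥(maximalRealSubfield L)) L (IsCMField.complexConj L) 1
          (Matrix.of fun i j : Fin 1 => if i.val + j.val + 1 = 1 then (1 : L) else 0))) ×
        ↥(UnitaryGroup.arch (↥(maximalRealSubfield L)) L (IsCMField.complexConj L) 3 H') => archCanonicalDelta L H' q.1 μ q.2)
      {q : (↥(UnitaryGroup.arch (↥(maximalRealSubfield L)) L (IsCMField.complexConj L) 2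
          (Matrix.of fun i j : Fin 2 => if i.val + j.val + 1 = 2 then (1 : L) else 0)) ×
        ↥(UnitaryGroup.arch (↥(maximalRealSubfield L)) L (IsCMField.complexConj L) 1
          (Matrix.of fun i j : Fin 1 => if i.val + j.val + 1 = 1 then (1 : L) else 0))) ×
        ↥(UnitaryGroup.arch (↥(maximalRealSubfield L)) L (IsCMField.complexConj L) 3 H') | IsArchNormPair L H' q.1 q.2 ∧ IsUnit ((archCharpolyTwo L q.1).eval (archGammaTwo L q.1))} (a₀, b₀) :=
  continuousOn_archCanonicalDelta_of_isUnit_eval L H' hherm hanis μ (a₀, b₀) ⟨hp, hunit⟩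

/-- **PRINT'S LIMIT FORM «`Δ_∞(γ_H(t), γ′(t)) → Δ_∞(γ_H, γ′)`» FOR `Δ‴_∞`**: along any filter `l`, a family of `(G,H)`-regular local matching pairs
`(γ_H(t), γ′(t))` converging to a `(G,H)`-regular local matching pair `(γ_H, γ′)` has `Δ‴_∞(γ_H(t), γ′(t)) → Δ‴_∞(γ_H, γ′)` (e.g. `γ_H δ_t ↔ γ₀ δ_t`, `t → 0`, at
print's singular `γ₀ ∈ M`; `H′` `c`-hermitian anisotropic). [cite: Rogawski1990, §8.2 Prop. 8.2.1 (a) pp. 117–118; §14.5 Lemma 14.5.2 (b) proof p. 238] -/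
theorem tendsto_archCanonicalDelta_of_isUnit_eval (hherm : (H'.map (cmConjRingHom L)).transpose = H')
    (hanis : ∀ x : Fin 3 → L, hermForm (cmConjRingHom L) H' x x = 0 → x = 0) (μ : HeckeCharacter L)
    {ι : Type*} {l : Filter ι} {γH : ι → (↥(UnitaryGroup.arch (↥(maximalRealSubfield L)) L (IsCMField.complexConj L) 2
          (Matrix.of fun i j : Fin 2 => if i.val + j.val + 1 = 2 then (1 : L) else 0)) ×
        ↥(UnitaryGroup.arch (↥(maximalRealSubfield L)) L (IsCMField.complexConj L) 1
          (Matrix.of fun i j : Fin 1 => if i.val + j.val + 1 = 1 then (1 : L) else 0)))} {γ : ι → ↥(UnitaryGroup.arch (↥(maximalRealSubfield L)) L (IsCMField.complexConj L) 3 H')} {a₀ : (↥(UnitaryGroup.arch (↥(maximalRealSubfield L)) L (IsCMField.complexConj L) 2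
          (Matrix.of fun i j : Fin 2 => if i.val + j.val + 1 = 2 then (1 : L) else 0)) ×
        ↥(UnitaryGroup.arch (↥(maximalRealSubfield L)) L (IsCMField.complexConj L) 1
          (Matrix.of fun i j : Fin 1 => if i.val + j.val + 1 = 1 then (1 : L) else 0)))} {b₀ : ↥(UnitaryGroup.arch (↥(maximalRealSubfield L)) L (IsCMField.complexConj L) 3 H')}
    (hlim : Tendsto (fun t => (γH t, γ t)) l (𝓝 (a₀, b₀)))
    (hS : ∀ᶠ t in l, IsArchNormPair L H' (γH t) (γ t) ∧ IsUnit ((archCharpolyTwo L (γH t)).eval (archGammaTwo L (γH t))))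
    (hp : IsArchNormPair L H' a₀ b₀) (hunit : IsUnit ((archCharpolyTwo L a₀).eval (archGammaTwo L a₀))) :
    Tendsto (fun t => archCanonicalDelta L H' (γH t) μ (γ t)) l (𝓝 (archCanonicalDelta L H' a₀ μ b₀)) := by
  have hl : Tendsto (fun t => (γH t, γ t)) l
      (𝓝[{q : (↥(UnitaryGroup.arch (↥(maximalRealSubfield L)) L (IsCMField.complexConj L) 2
          (Matrix.of fun i j : Fin 2 => if i.val + j.val + 1 = 2 then (1 : L) else 0)) ×
        ↥(UnitaryGroup.arch (↥(maximalRealSubfield L)) L (IsCMField.complexConj L) 1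
          (Matrix.of fun i j : Fin 1 => if i.val + j.val + 1 = 1 then (1 : L) else 0))) ×
        ↥(UnitaryGroup.arch (↥(maximalRealSubfield L)) L (IsCMField.complexConj L) 3 H') | IsArchNormPair L H' q.1 q.2 ∧ IsUnit ((archCharpolyTwo L q.1).eval (archGammaTwo L q.1))}] (a₀, b₀)) :=
    tendsto_nhdsWithin_iff.2 ⟨hlim, hS.mono fun t ht => ht⟩
  have h := (continuousWithinAt_archCanonicalDelta_of_isUnit_eval L H' hherm hanis μ hp hunit).tendsto.comp hl
  rw [Function.comp_def] at h
  exact h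

/-- The limit form for `Δ″_∞`. [cite: Rogawski1990, §8.2 Prop. 8.2.1 (a) pp. 117–118] -/
theorem tendsto_archExplicitDelta_of_isUnit_eval (hherm : (H'.map (cmConjRingHom L)).transpose = H')
    (hanis : ∀ x : Fin 3 → L, hermForm (cmConjRingHom L) H' x x = 0 → x = 0) (μ : HeckeCharacter L)
    {ι : Type*} {l : Filter ι} {γH : ι → (↥(UnitaryGroup.arch (↥(maximalRealSubfield L)) L (IsCMField.complexConj L) 2
          (Matrix.of fun i j : Fin 2 => if i.val + j.val + 1 = 2 then (1 : L) else 0)) ×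
        ↥(UnitaryGroup.arch (↥(maximalRealSubfield L)) L (IsCMField.complexConj L) 1
          (Matrix.of fun i j : Fin 1 => if i.val + j.val + 1 = 1 then (1 : L) else 0)))} {γ : ι → ↥(UnitaryGroup.arch (↥(maximalRealSubfield L)) L (IsCMField.complexConj L) 3 H')} {a₀ : (↥(UnitaryGroup.arch (↥(maximalRealSubfield L)) L (IsCMField.complexConj L) 2
          (Matrix.of fun i j : Fin 2 => if i.val + j.val + 1 = 2 then (1 : L) else 0)) ×
        ↥(UnitaryGroup.arch (↥(maximalRealSubfield L)) L (IsCMField.complexConj L) 1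
          (Matrix.of fun i j : Fin 1 => if i.val + j.val + 1 = 1 then (1 : L) else 0)))} {b₀ : ↥(UnitaryGroup.arch (↥(maximalRealSubfield L)) L (IsCMField.complexConj L) 3 H')}
    (hlim : Tendsto (fun t => (γH t, γ t)) l (𝓝 (a₀, b₀)))
    (hS : ∀ᶠ t in l, IsArchNormPair L H' (γH t) (γ t) ∧ IsUnit ((archCharpolyTwo L (γH t)).eval (archGammaTwo L (γH t))))
    (hp : IsArchNormPair L H' a₀ b₀) (hunit : IsUnit ((archCharpolyTwo L a₀).eval (archGammaTwo L a₀))) :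
    Tendsto (fun t => archExplicitDelta L H' (γH t) μ (γ t)) l (𝓝 (archExplicitDelta L H' a₀ μ b₀)) := by
  have hl : Tendsto (fun t => (γH t, γ t)) l
      (𝓝[{q : (↥(UnitaryGroup.arch (↥(maximalRealSubfield L)) L (IsCMField.complexConj L) 2
          (Matrix.of fun i j : Fin 2 => if i.val + j.val + 1 = 2 then (1 : L) else 0)) ×
        ↥(UnitaryGroup.arch (↥(maximalRealSubfield L)) L (IsCMField.complexConj L) 1
          (Matrix.of fun i j : Fin 1 => if i.val + j.val + 1 = 1 then (1 : L) else 0))) ×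
        ↥(UnitaryGroup.arch (↥(maximalRealSubfield L)) L (IsCMField.complexConj L) 3 H') | IsArchNormPair L H' q.1 q.2 ∧ IsUnit ((archCharpolyTwo L q.1).eval (archGammaTwo L q.1))}] (a₀, b₀)) :=
    tendsto_nhdsWithin_iff.2 ⟨hlim, hS.mono fun t ht => ht⟩
  have h := (continuousOn_archExplicitDelta_of_isUnit_eval L H' hherm hanis μ (a₀, b₀) ⟨hp, hunit⟩).tendsto.comp hl
  rw [Function.comp_def] at h
  exact h

end Literature.NumberTheory.Rogawski1990

end
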